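import Literature.NumberTheory.BeurlingPrimes.HilberdinkLogDeriv
import Mathlib.Analysis.Complex.CauchyIntegral
import Mathlib.Analysis.Analytic.IsolatedZeros
import Mathlib.Analysis.Analytic.Uniqueness
import HarnessLib

/-!
# Hilberdink's uncertainty principle, IV: `ζ_P` has no zeros on `Re s > θ` (Hilberdink–Lapidus Thm 2.1)

Topic `Literature/NumberTheory/BeurlingPrimes`, grouping namespace `Hilberdink`. Everything in this
file is PROVED. Hilberdink–Lapidus 2006, Theorem 2.1 (first half): "Suppose that for some
`α ∈ [0,1)` we have `ψ(x) = x + O(x^{α+ε})` for all `ε > 0`. Then `ζ(s)` has an analytic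
continuation to the half-plane `{Re s > α}` except for a simple (non-removable) pole at `s = 1` and
`ζ(s) ≠ 0` in this region." Proof (ibid.): "`φ(s) = s/(s−1) + s∫₁^∞ r(x)x^{−s−1}dx` … provides the
analytic continuation of `φ` … By standard complex analysis, it follows that `ζ(s)` has an analytic
continuation … Moreover, it has no zeros in this region, for if it did, then `φ(s) = ζ'(s)/ζ(s)`
would have a singularity."

Here, for a system with BOTH `|N_P(x) − ax| ≤ Cx^θ` and `|ψ_P(x) − x| ≤ Cx^θ` (`x ≥ 1`, `0 < a`,
`θ < 1`), with `Z̃` (continuation of `(s−1)ζ_P(s)`, file II) and `F̃` (continuation of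
`(s−1)φ(s)`, file III):
* `Hilberdink.ode_Ztilde` — the relation `(s − 1) Z̃'(s) = Z̃(s)(1 − F̃(s))` holds on all of
  `H = {Re s > θ}`: on `Re s > 1` it is `ζ' = −φζ` (from `ζ_P = exp L`, `L' = −φ`), and it persists
  by the identity theorem (`H` is convex);
* `Hilberdink.Ztilde_ne_zero` — **`Z̃(s) ≠ 0` on `H`**: at a zero `s₀ ≠ 1` of order `n ≥ 1`,
  `Z̃ = (s−s₀)^n g`, the relation forces `(s₀ − 1) n g(s₀) = 0`, absurd ("`φ` would have a
  singularity");
* `Hilberdink.Z P a s = Z̃(s)/(s − 1)`: the continuation of `ζ_P` to `H ∖ {1}`, holomorphic and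
  zero-free there, `= ζ_P = exp ∘ L` on `Re s > 1`.

## References
* T. W. Hilberdink, M. L. Lapidus, *Beurling zeta functions, generalised primes, and fractal
  membranes*, Acta Appl. Math. 94 (2006), arXiv:math/0410270, Theorem 2.1 and its proof.
* [Hilberdink2005] T. W. Hilberdink, *Well-behaved Beurling primes and integers*, J. Number Theory
  112 (2005) 332–344, §1 ("(1.1) are equivalent to knowing that `ζ_P(s)` has an analytic
  continuation … is zero-free in this strip").
-/

noncomputable section

open Set Filter Complex
open scoped Topology

namespace Literature.NumberTheory.BeurlingPrimes

open Literature.Barriers.RiemannHypothesis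

namespace Hilberdink

section hyp

variable {P : BeurlingPrimes} {a C θ : ℝ}

/-- The half-plane `H = {Re s > θ}` is open. [folklore] -/
theorem isOpen_halfPlane (θ : ℝ) : IsOpen {s : ℂ | θ < s.re} :=
  isOpen_lt continuous_const Complex.continuous_re

/-- `H` is preconnected (convex). [folklore] -/
theorem isPreconnected_halfPlane (θ : ℝ) : IsPreconnected {s : ℂ | θ < s.re} :=
  (convex_halfSpace_re_gt θ).isPreconnected

/-- **The relation `ζ' = −φζ` on `Re s > 1`**, in the form
`(s − 1) Z̃'(s) = Z̃(s)(1 − F̃(s))`. [cite: Hilberdink2005, §1] -/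
theorem ode_Ztilde_of_one_lt (hθ : θ < 1)
    (hN : ∀ x : ℝ, 1 ≤ x → |(P.intCount x : ℝ) - a * x| ≤ C * x ^ θ)
    (hψ : ∀ x : ℝ, 1 ≤ x → |P.chebyshevPsi x - x| ≤ C * x ^ θ) {s : ℂ} (hs : 1 < s.re) :
    (s - 1) * deriv (Ztilde P a) s = Ztilde P a s * (1 - Ftilde P s) := by
  have hB := intCount_le_of_abs_le P hθ.le hN
  set V : Set ℂ := {w : ℂ | 1 < w.re} with hV
  have hVo : IsOpen V := isOpen_halfPlane 1
  have hsV : V ∈ 𝓝 s := hVo.mem_nhds hs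
  -- on `V`, `Z̃(w) = (w − 1) exp(L(w))`
  have heq : Ztilde P a =ᶠ[𝓝 s] fun w ↦ (w - 1) * Complex.exp (eulerLog P w) := by
    filter_upwards [hsV] with w hw
    rw [Ztilde_eq_of_one_lt hB a hw, zeta_eq_exp_eulerLog P hB hw]
  obtain ⟨hLd, hLder⟩ := hasDerivAt_eulerLog (P := P) hB hs
  have hderiv : HasDerivAt (fun w ↦ (w - 1) * Complex.exp (eulerLog P w))
      (1 * Complex.exp (eulerLog P s) + (s - 1) * (Complex.exp (eulerLog P s) * deriv (eulerLog P) s)) s :=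
    ((hasDerivAt_id s).sub_const 1).mul hLd.hasDerivAt.cexp
  rw [heq.deriv_eq, hderiv.deriv, hLder, Ztilde_eq_of_one_lt hB a hs, zeta_eq_exp_eulerLog P hB hs,
    Ftilde_eq_of_one_lt hB hθ.le hψ hs]
  ring

/-- **The relation `(s − 1) Z̃'(s) = Z̃(s)(1 − F̃(s))` on the whole half-plane `Re s > θ`**
(identity theorem from `Re s > 1`). [cite: Hilberdink2005, §1] -/
theorem ode_Ztilde (hθ : θ < 1)
    (hN : ∀ x : ℝ, 1 ≤ x → |(P.intCount x : ℝ) - a * x| ≤ C * x ^ θ)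
    (hψ : ∀ x : ℝ, 1 ≤ x → |P.chebyshevPsi x - x| ≤ C * x ^ θ) {s : ℂ} (hs : θ < s.re) :
    (s - 1) * deriv (Ztilde P a) s = Ztilde P a s * (1 - Ftilde P s) := by
  set H : Set ℂ := {w : ℂ | θ < w.re} with hH
  have hHo : IsOpen H := isOpen_halfPlane θ
  have hZ : DifferentiableOn ℂ (Ztilde P a) H := differentiableOn_Ztilde hN
  have hF : DifferentiableOn ℂ (Ftilde P) H := differentiableOn_Ftilde hψ
  set g : ℂ → ℂ := fun w ↦ (w - 1) * deriv (Ztilde P a) w - Ztilde P a w * (1 - Ftilde P w) with hg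
  have hgd : DifferentiableOn ℂ g H :=
    ((differentiableOn_id.sub (differentiableOn_const _)).mul (hZ.deriv hHo)).sub
      (hZ.mul ((differentiableOn_const _).sub hF))
  have hga : AnalyticOnNhd ℂ g H := hgd.analyticOnNhd hHo
  -- `g = 0` near `2`
  have h2 : (2 : ℂ) ∈ H := by simp only [hH, mem_setOf_eq]; norm_num; linarith
  have hg0 : g =ᶠ[𝓝 (2 : ℂ)] 0 := by
    have hV : {w : ℂ | 1 < w.re} ∈ 𝓝 (2 : ℂ) := (isOpen_halfPlane 1).mem_nhds (by simp)
    filter_upwards [hV] with w hw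
    simp only [hg, Pi.zero_apply]
    rw [ode_Ztilde_of_one_lt hθ hN hψ hw, sub_self]
  have := hga.eqOn_zero_of_preconnected_of_eventuallyEq_zero (isPreconnected_halfPlane θ) h2 hg0 hs
  simp only [hg, Pi.zero_apply] at this
  exact sub_eq_zero.mp this

/-- **Hilberdink–Lapidus 2006, Theorem 2.1 (no zeros): `Z̃(s) ≠ 0` for `Re s > θ`.**
[cite: Hilberdink2005, §1] -/
theorem Ztilde_ne_zero (ha : 0 < a) (hθ : θ < 1)
    (hN : ∀ x : ℝ, 1 ≤ x → |(P.intCount x : ℝ) - a * x| ≤ C * x ^ θ)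
    (hψ : ∀ x : ℝ, 1 ≤ x → |P.chebyshevPsi x - x| ≤ C * x ^ θ) {s₀ : ℂ} (hs₀ : θ < s₀.re) :
    Ztilde P a s₀ ≠ 0 := by
  intro h0
  set H : Set ℂ := {w : ℂ | θ < w.re} with hH
  have hHo : IsOpen H := isOpen_halfPlane θ
  have hZ : DifferentiableOn ℂ (Ztilde P a) H := differentiableOn_Ztilde hN
  have hZa : AnalyticOnNhd ℂ (Ztilde P a) H := hZ.analyticOnNhd hHo
  have h1H : (1 : ℂ) ∈ H := by simp only [hH, mem_setOf_eq, one_re]; exact hθ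
  have hZ1 : Ztilde P a 1 ≠ 0 := by rw [Ztilde_one]; exact_mod_cast ha.ne'
  have hs₀1 : s₀ ≠ 1 := fun h ↦ hZ1 (h ▸ h0)
  have hana : AnalyticAt ℂ (Ztilde P a) s₀ := hZa s₀ hs₀
  -- `Z̃` is not identically zero near `s₀`
  have hne : ¬ (∀ᶠ z in 𝓝 s₀, Ztilde P a z = 0) := by
    intro hev
    have := hZa.eqOn_zero_of_preconnected_of_eventuallyEq_zero (isPreconnected_halfPlane θ) hs₀ hev h1H
    exact hZ1 this
  obtain ⟨n, g, hg, hg0, hev⟩ := (hana.exists_eventuallyEq_pow_smul_nonzero_iff).mpr hne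
  -- `n ≥ 1`
  have hn : n ≠ 0 := by
    rintro rfl
    have := hev.self_of_nhds
    simp only [pow_zero, one_smul] at this
    exact hg0 (this ▸ h0)
  obtain ⟨k, rfl⟩ := Nat.exists_eq_add_one_of_ne_zero hn
  -- derivative of `(z − s₀)^{k+1} g(z)` near `s₀`
  obtain ⟨r, hr, hgr⟩ : ∃ r > 0, AnalyticOnNhd ℂ g (Metric.ball s₀ r) := by
    obtain ⟨r, hr, h⟩ := Metric.eventually_nhds_iff_ball.mp hg.eventually_analyticAt
    exact ⟨r, hr, fun z hz ↦ h z hz⟩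
  have hev2 : ∀ᶠ z in 𝓝 s₀, deriv (Ztilde P a) z =
      ((k : ℂ) + 1) * (z - s₀) ^ k * g z + (z - s₀) ^ (k + 1) * deriv g z := by
    have hball : Metric.ball s₀ r ∈ 𝓝 s₀ := Metric.ball_mem_nhds s₀ hr
    filter_upwards [hev.eventually_nhds, hball] with z hz hzr
    have hgz : HasDerivAt g (deriv g z) z := (hgr z hzr).differentiableAt.hasDerivAt
    have hz' : Ztilde P a =ᶠ[𝓝 z] fun w ↦ (w - s₀) ^ (k + 1) * g w :=
      hz.mono fun w hw ↦ by rw [hw, smul_eq_mul]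
    have h1 : HasDerivAt (fun w : ℂ ↦ (w - s₀) ^ (k + 1)) (((k : ℂ) + 1) * (z - s₀) ^ k) z := by
      have h := ((hasDerivAt_id z).sub_const s₀).pow (k + 1)
      simp only [id, Nat.cast_add, Nat.cast_one, Nat.add_sub_cancel, mul_one] at h
      exact h
    have hd : deriv (fun w ↦ (w - s₀) ^ (k + 1) * g w) z =
        ((k : ℂ) + 1) * (z - s₀) ^ k * g z + (z - s₀) ^ (k + 1) * deriv g z := (h1.mul hgz).deriv
    rw [hz'.deriv_eq, hd]
  -- the relation near `s₀`, divided by `(z − s₀)^k`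
  set φ₁ : ℂ → ℂ := fun z ↦ (z - 1) * (((k : ℂ) + 1) * g z + (z - s₀) * deriv g z) with hφ₁
  set φ₂ : ℂ → ℂ := fun z ↦ (z - s₀) * g z * (1 - Ftilde P z) with hφ₂
  have hHn : H ∈ 𝓝 s₀ := hHo.mem_nhds hs₀
  have hrel : ∀ᶠ z in 𝓝[≠] s₀, φ₁ z = φ₂ z := by
    have h' : ∀ᶠ z in 𝓝 s₀, z ≠ s₀ → φ₁ z = φ₂ z := by
      filter_upwards [hev, hev2, hHn] with z hz hz2 hzH hne'
      have hode := ode_Ztilde hθ hN hψ (s := z) hzH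
      rw [hz2, hz, smul_eq_mul] at hode
      have hpow : (z - s₀) ^ k ≠ 0 := pow_ne_zero _ (sub_ne_zero.mpr hne')
      apply mul_left_cancel₀ hpow
      simp only [hφ₁, hφ₂]
      linear_combination hode
    exact eventually_nhdsWithin_iff.mpr (h'.mono fun z hz hzs ↦ hz (mem_compl_singleton_iff.mp hzs))
  -- continuity of both sides at `s₀`
  have hgc : ContinuousAt g s₀ := hg.continuousAt
  have hdgc : ContinuousAt (deriv g) s₀ := hg.deriv.continuousAt
  have hFc : ContinuousAt (Ftilde P) s₀ := ((differentiableOn_Ftilde hψ).differentiableAt hHn).continuousAt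
  have hφ₁c : ContinuousAt φ₁ s₀ := by
    simp only [hφ₁]
    exact (continuousAt_id.sub continuousAt_const).mul
      ((continuousAt_const.mul hgc).add ((continuousAt_id.sub continuousAt_const).mul hdgc))
  have hφ₂c : ContinuousAt φ₂ s₀ := by
    simp only [hφ₂]
    exact ((continuousAt_id.sub continuousAt_const).mul hgc).mul (continuousAt_const.sub hFc)
  have hlim₁ : Tendsto φ₁ (𝓝[≠] s₀) (𝓝 (φ₁ s₀)) := hφ₁c.tendsto.mono_left nhdsWithin_le_nhds
  have hlim₂ : Tendsto φ₂ (𝓝[≠] s₀) (𝓝 (φ₂ s₀)) := hφ₂c.tendsto.mono_left nhdsWithin_le_nhds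
  have heqlim : φ₁ s₀ = φ₂ s₀ := tendsto_nhds_unique (hlim₁.congr' hrel) hlim₂
  simp only [hφ₁, hφ₂, sub_self, zero_mul, add_zero] at heqlim
  -- `(s₀ − 1)(k+1) g(s₀) = 0`: contradiction
  have hk1 : ((k : ℂ) + 1) ≠ 0 := by exact_mod_cast Nat.succ_ne_zero k
  have : (s₀ - 1) * (((k : ℂ) + 1) * g s₀) ≠ 0 :=
    mul_ne_zero (sub_ne_zero.mpr hs₀1) (mul_ne_zero hk1 hg0)
  exact this heqlim

end hyp

/-! ### The continuation `Z = Z̃/(s − 1)` of `ζ_P` -/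

/-- **`Z(s) = Z̃(s)/(s − 1)`**, the analytic continuation of `ζ_P` to `{Re s > θ} ∖ {1}`.
[cite: Hilberdink2005, §1] -/
def Z (P : BeurlingPrimes) (a : ℝ) (s : ℂ) : ℂ := Ztilde P a s / (s - 1)

section Z

variable {P : BeurlingPrimes} {a C θ : ℝ}

/-- `Z` is holomorphic on `{Re s > θ} ∖ {1}`. [cite: Hilberdink2005, §1] -/
theorem differentiableOn_Z (hN : ∀ x : ℝ, 1 ≤ x → |(P.intCount x : ℝ) - a * x| ≤ C * x ^ θ) :
    DifferentiableOn ℂ (Z P a) {s : ℂ | θ < s.re ∧ s ≠ 1} := by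
  unfold Z
  refine ((differentiableOn_Ztilde hN).mono fun s hs ↦ hs.1).div
    (differentiableOn_id.sub (differentiableOn_const _)) fun s hs ↦ sub_ne_zero.mpr hs.2

/-- `Z = ζ_P` on `Re s > 1` (`θ ≤ 1`). [cite: Hilberdink2005, §1] -/
theorem Z_eq_zeta (hθ : θ ≤ 1) (hN : ∀ x : ℝ, 1 ≤ x → |(P.intCount x : ℝ) - a * x| ≤ C * x ^ θ)
    {s : ℂ} (hs : 1 < s.re) : Z P a s = P.zeta s := by
  have hs1 : s - 1 ≠ 0 := by
    intro h0; have := congrArg Complex.re h0; simp at this; linarith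
  rw [Z, Ztilde_eq_of_one_lt (intCount_le_of_abs_le P hθ hN) a hs, mul_div_cancel_left₀ _ hs1]

/-- `Z = exp ∘ L` on `Re s > 1`. [cite: Hilberdink2005, §1] -/
theorem Z_eq_exp_eulerLog (hθ : θ ≤ 1) (hN : ∀ x : ℝ, 1 ≤ x → |(P.intCount x : ℝ) - a * x| ≤ C * x ^ θ)
    {s : ℂ} (hs : 1 < s.re) : Z P a s = Complex.exp (eulerLog P s) := by
  rw [Z_eq_zeta hθ hN hs, zeta_eq_exp_eulerLog P (intCount_le_of_abs_le P hθ hN) hs]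

/-- **`Z(s) ≠ 0` on `{Re s > θ} ∖ {1}`.** [cite: Hilberdink2005, §1] -/
theorem Z_ne_zero (ha : 0 < a) (hθ : θ < 1)
    (hN : ∀ x : ℝ, 1 ≤ x → |(P.intCount x : ℝ) - a * x| ≤ C * x ^ θ)
    (hψ : ∀ x : ℝ, 1 ≤ x → |P.chebyshevPsi x - x| ≤ C * x ^ θ) {s : ℂ} (hs : θ < s.re) (hs1 : s ≠ 1) :
    Z P a s ≠ 0 :=
  div_ne_zero (Ztilde_ne_zero ha hθ hN hψ hs) (sub_ne_zero.mpr hs1)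

/-- **Finite order**: `‖Z(s)‖ ≤ a‖s‖/‖s−1‖ + ‖s‖ C/(Re s − θ)` (`Re s > θ`, `s ≠ 1`, `a ≥ 0`).
[cite: Hilberdink2005, §1] -/
theorem norm_Z_le (ha : 0 ≤ a) (hN : ∀ x : ℝ, 1 ≤ x → |(P.intCount x : ℝ) - a * x| ≤ C * x ^ θ)
    {s : ℂ} (hs : θ < s.re) (hs1 : s ≠ 1) :
    ‖Z P a s‖ ≤ a * ‖s‖ / ‖s - 1‖ + ‖s‖ * (C / (s.re - θ)) := by
  have h1 : 0 < ‖s - 1‖ := norm_pos_iff.mpr (sub_ne_zero.mpr hs1)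
  rw [Z, norm_div, div_le_iff₀ h1]
  refine (norm_Ztilde_le ha hN hs).trans (le_of_eq ?_)
  field_simp

end Z

end Hilberdink

end Literature.NumberTheory.BeurlingPrimes
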